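import Literature.RingTheory.MvPolynomial.LineChainConnectivity
import Literature.RingTheory.MvPolynomial.BoundedSolutionDegree

/-!
# Chains of lines on `V₊(F) ⊆ ℙᴺ`, `Σ deg Fₐ ≤ N - 1`, are defined over extensions of bounded degree

Topic: `Literature/RingTheory/MvPolynomial`. Let `k` be a field and `F_a` (`a < c`) forms of degrees
`d_a ≥ 1` in `N + 1` variables with `Σ_a d_a + 1 ≤ N`. Over an algebraically closed field any two
points of `V(F)` are joined by a chain of lines of `V(F)` with `r = Σ_a (d_a - 1) + 1` intermediate
points (`exists_chain_of_sum_deg_le_length`, Kollár V.4.8.1). **Here: there is an integer `Bd`,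
depending only on `(k, F)`, such that for every field `K ⊇ k` and all `p, q ∈ V(F)(K)` the chain
can be taken with coordinates in a field extension `E/K` of degree `[E : K] ≤ Bd`**
(`exists_chain_finrank_bound`).

Proof: for each pair of affine charts `(i, i')` the pairs `(p, q)` with `p_i = q_{i'} = 1` are the
field-valued points of the Noetherian ring `A = k[P, Q]/(F(P), F(Q), P_i - 1, Q_{i'} - 1)`, and
"`(v_1, …, v_r)` is a chain of lines of `V(F)` from `P` to `Q` with all `v_j ≠ 0`" is a polynomial
system over `A` (all coefficients of the binary forms `F_a(s·v_j + t·v_{j+1})`, `twoPointSubst`,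
and the Rabinowitsch equations `Σ_m v_{j,m} y_{j,m} = 1`); it is solvable at every algebraically
closed point by the chain theorem, hence solvable in bounded degree at every field-valued point by
`exists_finrank_bound_of_forall_exists_zero` (spreading out and Noetherian induction). This is the
input for the UNIFORM exponent of `CH₁(X)/⟨lines⟩` (the integer `N` of Kollár,
*Rational Curves on Algebraic Varieties* IV.3.13.3 = Tian–Zong 2014, Prop. 3.1, for chains of
lines) in `Literature/AlgebraicGeometry/Motives/LinesGenerateChowOneBoundedTorsion`.

## References

* J. Kollár, *Rational Curves on Algebraic Varieties*, Springer 1996, IV.3.13.3, V.4.8.1.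
* Z. Tian, H. R. Zong, *One-cycles on rationally connected varieties*, Compositio Math. 150 (2014)
  396–408, Prop. 3.1 and proof of Thm. 6.1. [TianZong2014]
-/

noncomputable section

open MvPolynomial Finset Module

namespace Literature.RingTheory.MvPolynomial

universe u

/-! ## Helpers: homogeneity, ring homomorphisms out of polynomial rings, the two-point substitution -/

section Helpers

variable {A : Type u} [CommRing A]

/-- `G(c · z) = c^n · G(z)` for a form `G` of degree `n` (any commutative ring). [folklore] -/
theorem eval_smul_eq_pow_mul_of_isHomogeneous {τ : Type*} {G : MvPolynomial τ A} {n : ℕ}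
    (hG : G.IsHomogeneous n) (c : A) (z : τ → A) : eval (c • z) G = c ^ n * eval z G := by
  classical
  simp only [MvPolynomial.eval_eq, Finset.mul_sum]
  refine Finset.sum_congr rfl fun s hs => ?_
  have hd : s.degree = n := by
    by_contra h
    exact (MvPolynomial.mem_support_iff.mp hs) (hG.coeff_eq_zero h)
  have hdeg : ∑ i ∈ s.support, s i = n := by rw [← hd]; rfl
  simp only [Pi.smul_apply, smul_eq_mul, mul_pow, Finset.prod_mul_distrib,
    Finset.prod_pow_eq_pow_sum, hdeg]
  ring

/-- A ring homomorphism out of a polynomial ring is evaluation: `θ(G) = G^{θ ∘ C}(θ(X_i))_i`.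
[folklore] -/
theorem ringHom_apply_eq_eval {τ T : Type*} [CommRing T] (θ : MvPolynomial τ A →+* T)
    (G : MvPolynomial τ A) : θ G = eval (fun i => θ (X i)) (map (θ.comp C) G) := by
  have h : ∀ p, θ p = eval₂Hom (θ.comp C) (fun i => θ (X i)) p :=
    hom_eq_hom _ _ (by ext r; simp only [RingHom.comp_apply, eval₂Hom_C]) (fun i => by simp)
  rw [h G, eval_map, coe_eval₂Hom]

/-- **Naturality of the two-point substitution** in the coefficient ring. [folklore] -/
theorem map_map_twoPointSubst {τ V T : Type*} [CommRing T] (φ : A →+* T)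
    (gL gR : τ → MvPolynomial V A) (G : MvPolynomial τ A) :
    map (map φ) (twoPointSubst gL gR G) =
      twoPointSubst (fun m => map φ (gL m)) (fun m => map φ (gR m)) (map φ G) := by
  induction G using MvPolynomial.induction_on with
  | C a => simp only [twoPointSubst_C, map_C]
  | add p q hp hq => simp only [map_add, hp, hq]
  | mul_X p m hp => simp only [map_mul, twoPointSubst_X, hp, map_X, map_add, map_C]

/-- The coefficients of `F(s·u + t·v)`, specialised at a point `(φ, x)`, are the coefficients of the
specialised binary form. [folklore] -/
theorem eval_map_coeff_twoPointSubst {τ V T : Type*} [CommRing T] (φ : A →+* T) (x : V → T)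
    (gL gR : τ → MvPolynomial V A) (G : MvPolynomial τ A) (e : Fin 2 →₀ ℕ) :
    eval x (map φ (coeff e (twoPointSubst gL gR G))) =
      coeff e (map (eval x)
        (twoPointSubst (fun m => map φ (gL m)) (fun m => map φ (gR m)) (map φ G))) := by
  rw [← map_map_twoPointSubst, coeff_map, coeff_map]

/-- Over an infinite domain, if `G` vanishes on the span of `u(x), v(x)` then all coefficients of
the binary form `G(s·u + t·v)` vanish at `x`. [folklore] -/
theorem coeff_map_eval_twoPointSubst_eq_zero {τ V L : Type*} [CommRing L] [IsDomain L] [Infinite L]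
    (gL gR : τ → MvPolynomial V L) (G : MvPolynomial τ L) (x : V → L)
    (h : ∀ s t : L, eval (fun m => s * eval x (gL m) + t * eval x (gR m)) G = 0)
    (e : Fin 2 →₀ ℕ) : coeff e (map (eval x) (twoPointSubst gL gR G)) = 0 := by
  have h0 : map (eval x) (twoPointSubst gL gR G) = 0 := by
    apply MvPolynomial.funext
    intro st
    rw [eval_map_twoPointSubst, map_zero]
    exact h (st 0) (st 1)
  rw [h0, coeff_zero]

/-- Conversely (any commutative ring), if all coefficients of `G(s·u + t·v)` vanish at `x` then `G`
vanishes on the span of `u(x), v(x)`. [folklore] -/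
theorem eval_smul_add_smul_eq_zero_of_forall_coeff {τ V T : Type*} [CommRing T]
    (gL gR : τ → MvPolynomial V T) (G : MvPolynomial τ T) (x : V → T)
    (h : ∀ e, coeff e (map (eval x) (twoPointSubst gL gR G)) = 0) (s t : T) :
    eval (fun m => s * eval x (gL m) + t * eval x (gR m)) G = 0 := by
  have h0 : map (eval x) (twoPointSubst gL gR G) = 0 := MvPolynomial.ext _ _ (by simpa using h)
  have h1 := eval_map_twoPointSubst gL gR G x ![s, t]
  rw [h0, map_zero] at h1
  simpa using h1.symm

end Helpers

/-! ## The chain scheme of a pair of affine charts as a polynomial system -/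

namespace ChainScheme

variable {k : Type u} [Field k] {N c : ℕ} (F : Fin c → MvPolynomial (Fin (N + 1)) k)
  (i i' : Fin (N + 1))

/-- Generators `F_a(P), F_a(Q), P_i - 1, Q_{i'} - 1` of the ideal of the chart ring. [folklore] -/
def gens : Set (MvPolynomial (Fin (N + 1) ⊕ Fin (N + 1)) k) :=
  (Set.range fun a => rename Sum.inl (F a)) ∪ (Set.range fun a => rename Sum.inr (F a)) ∪
    {X (Sum.inl i) - 1, X (Sum.inr i') - 1}

/-- The ideal `(F(P), F(Q), P_i - 1, Q_{i'} - 1) ⊆ k[P, Q]`. [folklore] -/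
def ideal : Ideal (MvPolynomial (Fin (N + 1) ⊕ Fin (N + 1)) k) := Ideal.span (gens F i i')

/-- **The chart ring `A = k[P, Q]/(F(P), F(Q), P_i - 1, Q_{i'} - 1)`**: its field-valued points
are the pairs `(p, q)` of zeros of `F` with `p_i = q_{i'} = 1`. [folklore] -/
abbrev Ring : Type u := MvPolynomial (Fin (N + 1) ⊕ Fin (N + 1)) k ⧸ ideal F i i'

/-- The structure map `k → A`. [folklore] -/
def ι : k →+* Ring F i i' := (Ideal.Quotient.mk (ideal F i i')).comp C

/-- The universal first point `P̄ ∈ A^{N+1}`. [folklore] -/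
def pb : Fin (N + 1) → Ring F i i' := fun m => Ideal.Quotient.mk (ideal F i i') (X (Sum.inl m))

/-- The universal last point `Q̄ ∈ A^{N+1}`. [folklore] -/
def qb : Fin (N + 1) → Ring F i i' := fun m => Ideal.Quotient.mk (ideal F i i') (X (Sum.inr m))

/-- `F_a(P)` lies in the ideal. [folklore] -/
theorem rename_inl_mem (a : Fin c) : rename Sum.inl (F a) ∈ ideal F i i' :=
  Ideal.subset_span (Or.inl (Or.inl ⟨a, rfl⟩))

/-- `F_a(Q)` lies in the ideal. [folklore] -/
theorem rename_inr_mem (a : Fin c) : rename Sum.inr (F a) ∈ ideal F i i' :=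
  Ideal.subset_span (Or.inl (Or.inr ⟨a, rfl⟩))

/-- `P_i - 1` lies in the ideal. [folklore] -/
theorem X_inl_sub_one_mem :
    (X (Sum.inl i) - 1 : MvPolynomial (Fin (N + 1) ⊕ Fin (N + 1)) k) ∈ ideal F i i' :=
  Ideal.subset_span (Or.inr (Set.mem_insert _ _))

/-- `Q_{i'} - 1` lies in the ideal. [folklore] -/
theorem X_inr_sub_one_mem :
    (X (Sum.inr i') - 1 : MvPolynomial (Fin (N + 1) ⊕ Fin (N + 1)) k) ∈ ideal F i i' :=
  Ideal.subset_span (Or.inr (Set.mem_insert_of_mem _ (Set.mem_singleton _)))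

/-- `P̄_i = 1`. [folklore] -/
theorem pb_self : pb F i i' i = 1 := by
  change Ideal.Quotient.mk _ (X (Sum.inl i)) = 1
  rw [← sub_eq_zero, ← map_one (Ideal.Quotient.mk (ideal F i i')), ← map_sub,
    Ideal.Quotient.eq_zero_iff_mem]
  exact X_inl_sub_one_mem F i i'

/-- `Q̄_{i'} = 1`. [folklore] -/
theorem qb_self : qb F i i' i' = 1 := by
  change Ideal.Quotient.mk _ (X (Sum.inr i')) = 1
  rw [← sub_eq_zero, ← map_one (Ideal.Quotient.mk (ideal F i i')), ← map_sub,
    Ideal.Quotient.eq_zero_iff_mem]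
  exact X_inr_sub_one_mem F i i'

/-- `F_a(P̄) = 0` at every point of `A`. [folklore] -/
theorem eval_pb (T : Type u) [CommRing T] (θ : Ring F i i' →+* T) (a : Fin c) :
    eval (fun m => θ (pb F i i' m)) (map (θ.comp (ι F i i')) (F a)) = 0 := by
  have h := ringHom_apply_eq_eval (θ.comp (Ideal.Quotient.mk (ideal F i i'))) (rename Sum.inl (F a))
  rw [map_rename, eval_rename, RingHom.comp_apply,
    Ideal.Quotient.eq_zero_iff_mem.mpr (rename_inl_mem F i i' a), map_zero] at h
  exact h.symm

/-- `F_a(Q̄) = 0` at every point of `A`. [folklore] -/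
theorem eval_qb (T : Type u) [CommRing T] (θ : Ring F i i' →+* T) (a : Fin c) :
    eval (fun m => θ (qb F i i' m)) (map (θ.comp (ι F i i')) (F a)) = 0 := by
  have h := ringHom_apply_eq_eval (θ.comp (Ideal.Quotient.mk (ideal F i i'))) (rename Sum.inr (F a))
  rw [map_rename, eval_rename, RingHom.comp_apply,
    Ideal.Quotient.eq_zero_iff_mem.mpr (rename_inr_mem F i i' a), map_zero] at h
  exact h.symm

/-- The variables of the chain system: `R` intermediate points and their Rabinowitsch partners.
[folklore] -/
abbrev Vars (R N : ℕ) : Type := (Fin R × Fin (N + 1)) ⊕ (Fin R × Fin (N + 1))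

/-- **The points of the prospective chain** `P̄ = m_0, m_1, …, m_R, m_{R+1} = m_{R+2} = ⋯ = Q̄`
as polynomials over `A` in the unknown intermediate points. [folklore] -/
def pts (R : ℕ) (j : ℕ) (m : Fin (N + 1)) : MvPolynomial (Vars R N) (Ring F i i') :=
  if j = 0 then C (pb F i i' m) else
    if h : j - 1 < R then X (Sum.inl (⟨j - 1, h⟩, m)) else C (qb F i i' m)

/-- **The chain system**: all coefficients of the binary forms `F_a(s·m_j + t·m_{j+1})` and the
Rabinowitsch equations `Σ_m m_{j,m} y_{j,m} = 1`. [folklore] -/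
def sys (R : ℕ) : (ℕ × Fin c × (Fin 2 →₀ ℕ)) ⊕ Fin R → MvPolynomial (Vars R N) (Ring F i i') :=
  Sum.elim
    (fun jae => coeff jae.2.2
      (twoPointSubst (pts F i i' R jae.1) (pts F i i' R (jae.1 + 1)) (map (ι F i i') (F jae.2.1))))
    (fun l => ∑ m, X (Sum.inl (l, m)) * X (Sum.inr (l, m)) - 1)

/-- The points of the chain at a point `(θ, x)`. [folklore] -/
theorem eval_map_pts (R : ℕ) (T : Type u) [CommRing T] (θ : Ring F i i' →+* T) (x : Vars R N → T)
    (j : ℕ) (m : Fin (N + 1)) :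
    eval x (map θ (pts F i i' R j m)) = if j = 0 then θ (pb F i i' m) else
      if h : j - 1 < R then x (Sum.inl (⟨j - 1, h⟩, m)) else θ (qb F i i' m) := by
  simp only [pts]
  split_ifs <;> simp

/-- A link equation at a point `(θ, x)` is a coefficient of the specialised binary form.
[folklore] -/
theorem eval_map_sys_inl (R : ℕ) (T : Type u) [CommRing T] (θ : Ring F i i' →+* T)
    (x : Vars R N → T) (j : ℕ) (a : Fin c) (e : Fin 2 →₀ ℕ) :
    eval x (map θ (sys F i i' R (Sum.inl (j, a, e)))) =
      coeff e (map (eval x) (twoPointSubst (fun m => map θ (pts F i i' R j m))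
        (fun m => map θ (pts F i i' R (j + 1) m)) (map (θ.comp (ι F i i')) (F a)))) := by
  change eval x (map θ (coeff e (twoPointSubst (pts F i i' R j) (pts F i i' R (j + 1))
    (map (ι F i i') (F a))))) = _
  rw [eval_map_coeff_twoPointSubst, MvPolynomial.map_map]

/-- A Rabinowitsch equation at a point `(θ, x)`. [folklore] -/
theorem eval_map_sys_inr (R : ℕ) (T : Type u) [CommRing T] (θ : Ring F i i' →+* T)
    (x : Vars R N → T) (l : Fin R) :
    eval x (map θ (sys F i i' R (Sum.inr l))) = ∑ m, x (Sum.inl (l, m)) * x (Sum.inr (l, m)) - 1 := by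
  change eval x (map θ (∑ m, X (Sum.inl (l, m)) * X (Sum.inr (l, m)) - 1)) = _
  simp only [map_sub, map_sum, map_mul, map_X, map_one, eval_X]

variable {F}

/-- **The chain system is solvable at every algebraically closed point** (the chain theorem
`exists_chain_of_sum_deg_le_length`). [cite: TianZong2014, proof of Thm. 6.1 (first sentence)] -/
theorem sys_solvable {d : Fin c → ℕ} (hF : ∀ a, (F a).IsHomogeneous (d a)) (hd : ∀ a, 0 < d a)
    (hN : ∑ a, d a + 1 ≤ N) {R : ℕ} (hR : ∑ a, (d a - 1) + 1 = R)
    (L : Type u) [Field L] [IsAlgClosed L] (φ : Ring F i i' →+* L) :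
    ∃ x : Vars R N → L, ∀ j, eval x (map φ (sys F i i' R j)) = 0 := by
  classical
  have hp0 : (fun m => φ (pb F i i' m)) ≠ 0 := fun h => by
    have h1 := congrFun h i
    rw [pb_self, map_one] at h1
    exact one_ne_zero h1
  have hq0 : (fun m => φ (qb F i i' m)) ≠ 0 := fun h => by
    have h1 := congrFun h i'
    rw [qb_self, map_one] at h1
    exact one_ne_zero h1
  obtain ⟨v, hv0, hvR, hvne, hvlink⟩ := exists_chain_of_sum_deg_le_length
    (F := fun a => map (φ.comp (ι F i i')) (F a)) (fun a => (hF a).map _) hd hN _ _ hp0 hq0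
    (eval_pb F i i' L φ) (eval_qb F i i' L φ)
  rw [hR] at hvR hvne hvlink
  have hsel : ∀ l : Fin R, ∃ m, v (l + 1) m ≠ 0 := fun l =>
    Function.ne_iff.mp (hvne (l + 1) (by omega))
  choose msel hmsel using hsel
  let x : Vars R N → L := Sum.elim (fun lm => v (lm.1 + 1) lm.2)
    (fun lm => if lm.2 = msel lm.1 then (v (lm.1 + 1) (msel lm.1))⁻¹ else 0)
  have hu : ∀ j m, eval x (map φ (pts F i i' R j m)) = v (min j (R + 1)) m := by
    intro j m
    rw [eval_map_pts]
    split_ifs with h0 h1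
    · subst h0
      rw [Nat.zero_min, hv0]
    · change v (j - 1 + 1) m = _
      rw [Nat.sub_add_cancel (Nat.one_le_iff_ne_zero.mpr h0), Nat.min_eq_left (by omega)]
    · rw [show min j (R + 1) = R + 1 by omega, hvR]
  refine ⟨x, ?_⟩
  rintro (⟨j, a, e⟩ | l)
  · rw [eval_map_sys_inl]
    refine coeff_map_eval_twoPointSubst_eq_zero _ _ _ x (fun s t => ?_) e
    simp only [hu]
    by_cases hj : j ≤ R
    · rw [Nat.min_eq_left (by omega : j ≤ R + 1), Nat.min_eq_left (by omega : j + 1 ≤ R + 1)]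
      have h := hvlink j hj a s t
      have hfun : (fun m => s * v j m + t * v (j + 1) m) = s • v j + t • v (j + 1) := by
        funext m; simp [Pi.add_apply, Pi.smul_apply, smul_eq_mul]
      rw [hfun]; exact h
    · rw [show min j (R + 1) = R + 1 by omega, show min (j + 1) (R + 1) = R + 1 by omega, hvR]
      have hst : (fun m => s * φ (qb F i i' m) + t * φ (qb F i i' m)) =
          (s + t) • fun m => φ (qb F i i' m) := by
        funext m; simp only [Pi.smul_apply, smul_eq_mul]; ring
      rw [hst, eval_smul_eq_pow_mul_of_isHomogeneous ((hF a).map _), eval_qb F i i' L φ a,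
        mul_zero]
  · rw [eval_map_sys_inr]
    simp only [x, Sum.elim_inl, Sum.elim_inr]
    rw [Finset.sum_eq_single (msel l) (fun m _ hm => by rw [if_neg hm, mul_zero])
      (fun h => absurd (Finset.mem_univ _) h), if_pos rfl, mul_inv_cancel₀ (hmsel l), sub_self]

/-- **The point of `A` defined by a pair `(p, q)` of zeros with `p_i = q_{i'} = 1`.** [folklore] -/
theorem exists_ringHom {K : Type u} [Field K] [Algebra k K] (p q : Fin (N + 1) → K)
    (hp1 : p i = 1) (hq1 : q i' = 1) (hp : ∀ a, eval p (map (algebraMap k K) (F a)) = 0)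
    (hq : ∀ a, eval q (map (algebraMap k K) (F a)) = 0) :
    ∃ φ : Ring F i i' →+* K, (∀ m, φ (pb F i i' m) = p m) ∧ (∀ m, φ (qb F i i' m) = q m) ∧
      φ.comp (ι F i i') = algebraMap k K := by
  let ev : MvPolynomial (Fin (N + 1) ⊕ Fin (N + 1)) k →+* K :=
    eval₂Hom (algebraMap k K) (Sum.elim p q)
  have hle : ideal F i i' ≤ RingHom.ker ev := by
    change Ideal.span (gens F i i') ≤ _
    rw [Ideal.span_le]
    rintro g ((⟨a, rfl⟩ | ⟨a, rfl⟩) | hg')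
    · rw [SetLike.mem_coe, RingHom.mem_ker]
      change eval₂ (algebraMap k K) (Sum.elim p q) (rename Sum.inl (F a)) = 0
      rw [eval₂_rename, ← eval_map]
      exact hp a
    · rw [SetLike.mem_coe, RingHom.mem_ker]
      change eval₂ (algebraMap k K) (Sum.elim p q) (rename Sum.inr (F a)) = 0
      rw [eval₂_rename, ← eval_map]
      exact hq a
    · rw [SetLike.mem_coe, RingHom.mem_ker]
      rcases hg' with rfl | hg'
      · rw [map_sub, map_one]
        change eval₂Hom (algebraMap k K) (Sum.elim p q) (X (Sum.inl i)) - 1 = 0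
        rw [eval₂Hom_X']
        change p i - 1 = 0
        rw [hp1, sub_self]
      · rw [Set.mem_singleton_iff] at hg'
        subst hg'
        rw [map_sub, map_one]
        change eval₂Hom (algebraMap k K) (Sum.elim p q) (X (Sum.inr i')) - 1 = 0
        rw [eval₂Hom_X']
        change q i' - 1 = 0
        rw [hq1, sub_self]
  have hev : ∀ g ∈ ideal F i i', ev g = 0 := fun g hg => hle hg
  refine ⟨Ideal.Quotient.lift _ ev hev, fun m => ?_, fun m => ?_, ?_⟩
  · change Ideal.Quotient.lift _ ev hev (Ideal.Quotient.mk _ (X (Sum.inl m))) = p m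
    rw [Ideal.Quotient.lift_mk]
    exact eval₂Hom_X' _ _ _
  · change Ideal.Quotient.lift _ ev hev (Ideal.Quotient.mk _ (X (Sum.inr m))) = q m
    rw [Ideal.Quotient.lift_mk]
    exact eval₂Hom_X' _ _ _
  · ext r
    change Ideal.Quotient.lift _ ev hev (Ideal.Quotient.mk _ (C r)) = _
    rw [Ideal.Quotient.lift_mk]
    exact eval₂Hom_C _ _ _

/-- **A zero of the chain system at a point `(Φ, x)` is a chain of lines** `w_j = m_j(x)` of `V(F)`
from `Φ(P̄)` to `Φ(Q̄)` with all `w_j ≠ 0` (`j ≤ R + 1`). [folklore] -/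
theorem chain_of_zero {R : ℕ} {E : Type u} [Field E] (Φ : Ring F i i' →+* E) (x : Vars R N → E)
    (hx : ∀ j, eval x (map Φ (sys F i i' R j)) = 0) :
    (∀ j, R + 1 ≤ j → (fun m => eval x (map Φ (pts F i i' R j m))) = fun m => Φ (qb F i i' m)) ∧
    (∀ j ≤ R + 1, (fun m => eval x (map Φ (pts F i i' R j m))) ≠ 0) ∧
    ∀ j a (s t : E), eval (s • (fun m => eval x (map Φ (pts F i i' R j m))) +
      t • (fun m => eval x (map Φ (pts F i i' R (j + 1) m)))) (map (Φ.comp (ι F i i')) (F a)) = 0 := by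
  have hwR : ∀ j, R + 1 ≤ j →
      (fun m => eval x (map Φ (pts F i i' R j m))) = fun m => Φ (qb F i i' m) := by
    intro j hj
    funext m
    rw [eval_map_pts, if_neg (by omega), dif_neg (by omega)]
  refine ⟨hwR, fun j hj => ?_, fun j a s t => ?_⟩
  · rcases Nat.eq_zero_or_pos j with rfl | hj1
    · intro h
      have h1 := congrFun h i
      simp only [eval_map_pts, if_true, pb_self, map_one, Pi.zero_apply] at h1
      exact one_ne_zero h1
    by_cases hjR : j ≤ R
    · intro h0
      have hlt : j - 1 < R := by omega
      have hx0 : ∀ m, x (Sum.inl (⟨j - 1, hlt⟩, m)) = 0 := fun m => by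
        have h1 := congrFun h0 m
        simp only [eval_map_pts, if_neg (Nat.pos_iff_ne_zero.mp hj1), dif_pos hlt,
          Pi.zero_apply] at h1
        exact h1
      have h := hx (Sum.inr ⟨j - 1, hlt⟩)
      rw [eval_map_sys_inr] at h
      simp only [hx0, zero_mul, Finset.sum_const_zero, zero_sub, neg_eq_zero] at h
      exact one_ne_zero h
    · rw [hwR j (by omega)]
      intro h
      have h1 := congrFun h i'
      simp only [qb_self, map_one, Pi.zero_apply] at h1
      exact one_ne_zero h1
  · have hcoef : ∀ e, coeff e (map (eval x) (twoPointSubst (fun m => map Φ (pts F i i' R j m))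
        (fun m => map Φ (pts F i i' R (j + 1) m)) (map (Φ.comp (ι F i i')) (F a)))) = 0 := by
      intro e
      rw [← eval_map_sys_inl]
      exact hx (Sum.inl (j, a, e))
    have h := eval_smul_add_smul_eq_zero_of_forall_coeff _ _ _ x hcoef s t
    have hfun : (fun m => s * eval x (map Φ (pts F i i' R j m)) +
        t * eval x (map Φ (pts F i i' R (j + 1) m))) =
        s • (fun m => eval x (map Φ (pts F i i' R j m))) +
          t • (fun m => eval x (map Φ (pts F i i' R (j + 1) m))) := by
      funext m; simp [Pi.add_apply, Pi.smul_apply, smul_eq_mul]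
    rw [hfun] at h
    exact h

end ChainScheme

/-! ## Chains of bounded degree -/

section Main

variable {k : Type u} [Field k] {N c : ℕ}

open ChainScheme in
/-- **Chains of lines of bounded degree, for one pair of affine charts.** For forms `F_a` of
degrees `d_a ≥ 1` with `Σ d_a + 1 ≤ N` and chart indices `i, i'`, there is `B` such that for every
field `K ⊇ k` and all `p, q ∈ V(F)(K)` with `p_i = q_{i'} = 1` there are a field extension `E/K`
with `0 < [E : K] ≤ B` and a chain `p = w_0, w_1, …, w_{r+1} = q` (`r = Σ (d_a - 1) + 1`,
`w_j = q` for `j ≥ r + 1`) of non-zero vectors of `E^{N+1}` with every `F_a` vanishing on the span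
of each consecutive pair: apply `exists_finrank_bound_of_forall_exists_zero` to the chain system
of the chart ring, solvable at algebraically closed points by `ChainScheme.sys_solvable`.
[cite: TianZong2014, proof of Thm. 6.1 and Prop. 3.1] -/
theorem exists_chain_finrank_bound_chart (F : Fin c → MvPolynomial (Fin (N + 1)) k)
    (d : Fin c → ℕ) (hF : ∀ a, (F a).IsHomogeneous (d a)) (hd : ∀ a, 0 < d a)
    (hN : ∑ a, d a + 1 ≤ N) (i i' : Fin (N + 1)) :
    ∃ B : ℕ, ∀ (K : Type u) [Field K] [Algebra k K] (p q : Fin (N + 1) → K), p i = 1 → q i' = 1 →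
      (∀ a, eval p (map (algebraMap k K) (F a)) = 0) →
      (∀ a, eval q (map (algebraMap k K) (F a)) = 0) →
      ∃ (E : Type u) (_ : Field E) (_ : Algebra K E), finrank K E ≤ B ∧ 0 < finrank K E ∧
        ∃ w : ℕ → Fin (N + 1) → E, w 0 = algebraMap K E ∘ p ∧
          (∀ j, ∑ a, (d a - 1) + 1 + 1 ≤ j → w j = algebraMap K E ∘ q) ∧
          (∀ j ≤ ∑ a, (d a - 1) + 1 + 1, w j ≠ 0) ∧
          ∀ j a (s t : E), eval (s • w j + t • w (j + 1))
            (map ((algebraMap K E).comp (algebraMap k K)) (F a)) = 0 := by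
  classical
  obtain ⟨R, hR⟩ : ∃ R, ∑ a, (d a - 1) + 1 = R := ⟨_, rfl⟩
  rw [hR]
  obtain ⟨B, hB⟩ := exists_finrank_bound_of_forall_exists_zero (sys F i i' R)
    (sys_solvable i i' hF hd hN hR)
  refine ⟨B, fun K _ _ p q hp1 hq1 hp hq => ?_⟩
  obtain ⟨φK, hφpb, hφqb, hφι⟩ := exists_ringHom i i' p q hp1 hq1 hp hq
  obtain ⟨E, _, _, hBle, hpos, x, hx⟩ := hB K φK
  obtain ⟨hwR, hwne, hwlink⟩ := chain_of_zero i i' ((algebraMap K E).comp φK) x hx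
  refine ⟨E, inferInstance, inferInstance, hBle, hpos,
    fun j m => eval x (map ((algebraMap K E).comp φK) (pts F i i' R j m)), ?_, fun j hj => ?_,
    hwne, fun j a s t => ?_⟩
  · funext m
    change eval x (map ((algebraMap K E).comp φK) (pts F i i' R 0 m)) = algebraMap K E (p m)
    rw [eval_map_pts, if_pos rfl, RingHom.comp_apply, hφpb]
  · change (fun m => eval x (map ((algebraMap K E).comp φK) (pts F i i' R j m))) = _
    rw [hwR j hj]
    funext m
    rw [RingHom.comp_apply, hφqb]
    rfl
  · have h := hwlink j a s t
    rwa [RingHom.comp_assoc, hφι] at h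

/-- **Chains of lines on `V(F)` are defined over extensions of bounded degree.** For forms `F_a` of
degrees `d_a ≥ 1` in `N + 1` variables over a field `k` with `Σ_a d_a + 1 ≤ N` there is an
integer `Bd` such that: for every field `K ⊇ k` and all non-zero `p, q ∈ K^{N+1}` with
`F(p) = F(q) = 0` there are a field extension `E/K` with `0 < [E : K] ≤ Bd` and a chain
`p = v_0, v_1, …, v_{r+1} = q` of non-zero vectors of `E^{N+1}` with every `F_a` vanishing
identically on the span of each consecutive pair (`r = Σ_a (d_a - 1) + 1`). Over an algebraically
closed `K` this is the chain theorem `exists_chain_of_sum_deg_le` with `E = K` (Kollár V.4.8.1);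
the bound on the degree of the field of definition is what makes the torsion exponent of
`CH₁(X)/⟨lines⟩` uniform (Kollár IV.3.13.3 / Tian–Zong Prop. 3.1: "there is a positive integer `N`
… such that for any 1-cycle `D` … `N · D ∼ Σ mᵢ u_*(Fᵢ)`").
[cite: TianZong2014, Prop. 3.1 and proof of Thm. 6.1] -/
theorem exists_chain_finrank_bound (F : Fin c → MvPolynomial (Fin (N + 1)) k) (d : Fin c → ℕ)
    (hF : ∀ a, (F a).IsHomogeneous (d a)) (hd : ∀ a, 0 < d a) (hN : ∑ a, d a + 1 ≤ N) :
    ∃ Bd : ℕ, ∀ (K : Type u) [Field K] [Algebra k K] (p q : Fin (N + 1) → K), p ≠ 0 → q ≠ 0 →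
      (∀ a, eval p (map (algebraMap k K) (F a)) = 0) →
      (∀ a, eval q (map (algebraMap k K) (F a)) = 0) →
      ∃ (E : Type u) (_ : Field E) (_ : Algebra K E), finrank K E ≤ Bd ∧ 0 < finrank K E ∧
        ∃ (r : ℕ) (v : ℕ → Fin (N + 1) → E), v 0 = algebraMap K E ∘ p ∧
          v (r + 1) = algebraMap K E ∘ q ∧ (∀ j ≤ r + 1, v j ≠ 0) ∧
          ∀ j ≤ r, ∀ a (s t : E), eval (s • v j + t • v (j + 1))
            (map ((algebraMap K E).comp (algebraMap k K)) (F a)) = 0 := by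
  classical
  choose B hB using fun ii' : Fin (N + 1) × Fin (N + 1) =>
    exists_chain_finrank_bound_chart F d hF hd hN ii'.1 ii'.2
  refine ⟨Finset.univ.sup B, fun K _ _ p q hp0 hq0 hp hq => ?_⟩
  obtain ⟨i, hi⟩ := Function.ne_iff.mp hp0
  obtain ⟨i', hi'⟩ := Function.ne_iff.mp hq0
  have hp'1 : ((p i)⁻¹ • p) i = 1 := by
    rw [Pi.smul_apply, smul_eq_mul, inv_mul_cancel₀ hi]
  have hq'1 : ((q i')⁻¹ • q) i' = 1 := by
    rw [Pi.smul_apply, smul_eq_mul, inv_mul_cancel₀ hi']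
  have hp'z : ∀ a, eval ((p i)⁻¹ • p) (map (algebraMap k K) (F a)) = 0 := fun a => by
    rw [eval_smul_eq_pow_mul_of_isHomogeneous ((hF a).map _), hp a, mul_zero]
  have hq'z : ∀ a, eval ((q i')⁻¹ • q) (map (algebraMap k K) (F a)) = 0 := fun a => by
    rw [eval_smul_eq_pow_mul_of_isHomogeneous ((hF a).map _), hq a, mul_zero]
  obtain ⟨E, _, _, hBle, hpos, w, hw0, hwR, hwne, hwlink⟩ :=
    hB (i, i') K ((p i)⁻¹ • p) ((q i')⁻¹ • q) hp'1 hq'1 hp'z hq'z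
  -- rescale the end points back to `p` and `q`
  set R := ∑ a, (d a - 1) + 1 with hR
  let κ : ℕ → E := fun j =>
    if j = 0 then algebraMap K E (p i) else if j ≤ R then 1 else algebraMap K E (q i')
  have hκ : ∀ j, κ j ≠ 0 := by
    intro j
    simp only [κ]
    split_ifs
    · exact (map_ne_zero _).mpr hi
    · exact one_ne_zero
    · exact (map_ne_zero _).mpr hi'
  refine ⟨E, inferInstance, inferInstance,
    hBle.trans (Finset.le_sup (f := B) (Finset.mem_univ (i, i'))), hpos, R, fun j => κ j • w j,
    ?_, ?_, fun j hj => smul_ne_zero (hκ j) (hwne j hj), fun j _ a s t => ?_⟩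
  · change κ 0 • w 0 = _
    rw [hw0]
    funext m
    simp only [κ, if_pos rfl, Pi.smul_apply, Function.comp_apply, smul_eq_mul, ← map_mul,
      mul_inv_cancel_left₀ hi]
  · change κ (R + 1) • w (R + 1) = _
    rw [hwR (R + 1) le_rfl]
    funext m
    simp only [κ, if_neg (Nat.succ_ne_zero R), if_neg (Nat.not_succ_le_self R), Pi.smul_apply,
      Function.comp_apply, smul_eq_mul, ← map_mul, mul_inv_cancel_left₀ hi']
  · change eval (s • (κ j • w j) + t • (κ (j + 1) • w (j + 1))) _ = 0
    rw [smul_smul, smul_smul]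
    exact hwlink j a _ _

end Main

end Literature.RingTheory.MvPolynomial

end
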